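import Summits.Ventures.Crystal3D.Theorems.StickyWulffConstantGenericWallFloorGeneralRungAll
import Summits.Ventures.Crystal3D.Theorems.StickyWulffConstantGenericWallFloorAffineSampleDeficit
import Summits.Ventures.Crystal3D.Theses.StickyWulffConstant
import Summits.Ventures.Crystal3D.Theorems.StickyWulffConstantNoReconstructionGainLatticeAdhesion
import Summits.Ventures.Crystal3D.StickySpheres.FinsetBridge
import HarnessLib

/-!
# The crux `GenericWallFloor` at a pair-dependent positive charge, for ALL non-co-axial pairs

HONEST FRAMING. Venture `Summits/Ventures/Crystal3D` (cell `crystal3d-full`), helper for the crux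
`GenericWallFloor` (stmt-Ventures-19480) of `route-Ventures-StickyWulffConstant`, REGISTERED line `WallLedgerG`.
Rung credit only; F-C1 not moved; the crux itself (charge `1·π`) is NOT closed here.

`genericWallFloor_posCharge`: the crux's statement VERBATIM except that the unit charge `+ 1` in
`(φ₁ + φ₂ + 1)·π·ρ²` is replaced by a pair-dependent `+ κ` with `κ > 0` (inputs `KissingGap δ`,
`KissingClassification δ` BY NAME): for every NON-CO-AXIAL pair of clamped fcc grains, every unit packing of the
clamped cylinder cell has
`6N − numContacts ≥ (φ₁ + φ₂ + κ)·π·ρ² − C(1 + h)ρ`.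
Composition = the registered skeleton `GenericWallFloor_holds_of_stubs` with the landed `stub_affineSampleDeficit`
and, in place of `stub_twoSlabAdhesion`, the `h`-free general-filling rung
`general_twoSlabAdhesion_charge_of_not_coaxial` (refusal walks).  This is the qualitative form («every wall between
non-co-axial grains has positive free energy per unit area, uniformly in the thickness») of the crux for all pairs.
WHAT THIS IS NOT: the crux (charge `1`); F-C1 not moved.
-/

noncomputable section

namespace Summit.Ventures.Crystal3D.Theorems

open Summit.Ventures.Crystal3D Finset Real
open Summit.Ventures.Crystal3D.Cruxes.GenericWallFloor.WallLedgerG (AffineSampleDeficit)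
open Literature.MathematicalPhysics.StatisticalMechanics (fccStacking barlowStacking IsHaggSeq contactDeficiency)
open scoped InnerProductSpace

/-- **`GenericWallFloor` at a positive pair-dependent charge, all non-co-axial pairs.**  See the module
docstring. -/
theorem genericWallFloor_posCharge {δ : ℝ} (hg : KissingGap δ) (hc : KissingClassification δ)
    (A₁ : EuclideanSpace ℝ (Fin 3) ≃ₗᵢ[ℝ] EuclideanSpace ℝ (Fin 3)) (t₁ : EuclideanSpace ℝ (Fin 3))
    (A₂ : EuclideanSpace ℝ (Fin 3) ≃ₗᵢ[ℝ] EuclideanSpace ℝ (Fin 3)) (t₂ : EuclideanSpace ℝ (Fin 3))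
    (hnc : ¬ ∃ (L : EuclideanSpace ℝ (Fin 3) ≃ₗᵢ[ℝ] EuclideanSpace ℝ (Fin 3))
        (s₁ s₂ : EuclideanSpace ℝ (Fin 3)) (σ σ' : ℤ → ℤ), IsHaggSeq σ ∧ IsHaggSeq σ' ∧
        (fun p => A₁ p + t₁) '' fccStacking 1 (Real.sqrt (2 / 3)) ⊆
          (fun p => L p + s₁) '' barlowStacking 1 (Real.sqrt (2 / 3)) σ ∧
        (fun p => A₂ p + t₂) '' fccStacking 1 (Real.sqrt (2 / 3)) ⊆
          (fun p => L p + s₂) '' barlowStacking 1 (Real.sqrt (2 / 3)) σ') :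
    ∃ κ : ℝ, 0 < κ ∧ ∃ C R₀ : ℝ, 0 < R₀ ∧ ∀ h : ℝ, 0 ≤ h → ∀ ρ : ℝ, R₀ ≤ ρ →
      ∀ (N : ℕ) (x : Fin N → EuclideanSpace ℝ (Fin 3)), IsUnitPacking x →
      (∀ i, -(2 * R₀) ≤ x i 2 ∧ x i 2 ≤ h + 2 * R₀ ∧ x i 0 ^ 2 + x i 1 ^ 2 ≤ ρ ^ 2) →
      (∀ p ∈ (fun p => A₁ p + t₁) '' fccStacking 1 (Real.sqrt (2 / 3)),
        (-(2 * R₀) ≤ p 2 ∧ p 2 ≤ -R₀ ∧ p 0 ^ 2 + p 1 ^ 2 ≤ ρ ^ 2) → ∃ i, x i = p) →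
      (∀ p ∈ (fun p => A₂ p + t₂) '' fccStacking 1 (Real.sqrt (2 / 3)),
        (h + R₀ ≤ p 2 ∧ p 2 ≤ h + 2 * R₀ ∧ p 0 ^ 2 + p 1 ^ 2 ≤ ρ ^ 2) → ∃ i, x i = p) →
      (Real.sqrt 2 / 4 * ∑ᶠ w ∈ {w ∈ fccStacking 1 (Real.sqrt (2 / 3)) | ‖w‖ = 1},
          |⟪w, A₁.symm (EuclideanSpace.single (2 : Fin 3) (1 : ℝ))⟫_ℝ| +
        Real.sqrt 2 / 4 * ∑ᶠ w ∈ {w ∈ fccStacking 1 (Real.sqrt (2 / 3)) | ‖w‖ = 1},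
          |⟪w, A₂.symm (EuclideanSpace.single (2 : Fin 3) (1 : ℝ))⟫_ℝ|) * Real.pi * ρ ^ 2 + κ * ρ ^ 2 -
        C * (1 + h) * ρ ≤ 6 * (N : ℝ) - (numContacts x : ℝ) := by
  classical
  have hS : AffineSampleDeficit := stub_affineSampleDeficit
  obtain ⟨κ, hκ, C, R₀, hR₀, hadh⟩ := general_twoSlabAdhesion_charge_of_not_coaxial hg hc A₁ t₁ A₂ t₂ hnc
  obtain ⟨C₁, hC₁⟩ := hS A₁ t₁ R₀ hR₀
  obtain ⟨C₂, hC₂⟩ := hS A₂ t₂ R₀ hR₀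
  refine ⟨κ, hκ, |C| + |C₁| + |C₂|, R₀, by linarith, ?_⟩
  intro h hh ρ hρ N x hx hcyl hslab₁ hslab₂
  set φ₁ : ℝ := Real.sqrt 2 / 4 * ∑ᶠ w ∈ {w ∈ fccStacking 1 (Real.sqrt (2 / 3)) | ‖w‖ = 1},
      |⟪w, A₁.symm (EuclideanSpace.single (2 : Fin 3) (1 : ℝ))⟫_ℝ| with hφ₁
  set φ₂ : ℝ := Real.sqrt 2 / 4 * ∑ᶠ w ∈ {w ∈ fccStacking 1 (Real.sqrt (2 / 3)) | ‖w‖ = 1},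
      |⟪w, A₂.symm (EuclideanSpace.single (2 : Fin 3) (1 : ℝ))⟫_ℝ| with hφ₂
  have hxinj : Function.Injective x := hx.injective
  set X : Finset (EuclideanSpace ℝ (Fin 3)) := univ.image x with hX
  set P₁ : Finset (EuclideanSpace ℝ (Fin 3)) := X.filter fun p =>
    p ∈ (fun q => A₁ q + t₁) '' fccStacking 1 (Real.sqrt (2 / 3)) ∧
      -(2 * R₀) ≤ p 2 ∧ p 2 ≤ -R₀ ∧ p 0 ^ 2 + p 1 ^ 2 ≤ ρ ^ 2 with hP₁
  set P₂ : Finset (EuclideanSpace ℝ (Fin 3)) := (X \ P₁).filter fun p =>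
    p ∈ (fun q => A₂ q + t₂) '' fccStacking 1 (Real.sqrt (2 / 3)) ∧
      h + R₀ ≤ p 2 ∧ p 2 ≤ h + 2 * R₀ ∧ p 0 ^ 2 + p 1 ^ 2 ≤ ρ ^ 2 with hP₂
  have hXpack : ∀ p ∈ X, ∀ q ∈ X, p ≠ q → 1 ≤ dist p q := by
    intro p hp q hq hpq
    obtain ⟨i, -, rfl⟩ := mem_image.1 hp
    obtain ⟨j, -, rfl⟩ := mem_image.1 hq
    exact hx.one_le_dist fun hij => hpq (by rw [hij])
  have hP₁X : P₁ ⊆ X := filter_subset _ _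
  have hP₂X : P₂ ⊆ X \ P₁ := filter_subset _ _
  have hXcyl : ∀ p ∈ X, -(2 * R₀) ≤ p 2 ∧ p 2 ≤ h + 2 * R₀ ∧ p 0 ^ 2 + p 1 ^ 2 ≤ ρ ^ 2 := by
    intro p hp
    obtain ⟨i, -, rfl⟩ := mem_image.1 hp
    exact hcyl i
  have hP₁iff : ∀ p, p ∈ P₁ ↔ (p ∈ (fun q => A₁ q + t₁) '' fccStacking 1 (Real.sqrt (2 / 3)) ∧
      -(2 * R₀) ≤ p 2 ∧ p 2 ≤ -R₀ ∧ p 0 ^ 2 + p 1 ^ 2 ≤ ρ ^ 2) := by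
    intro p
    rw [hP₁, mem_filter]
    refine ⟨fun hp => hp.2, fun hp => ⟨?_, hp⟩⟩
    obtain ⟨i, hi⟩ := hslab₁ p hp.1 ⟨hp.2.1, hp.2.2.1, hp.2.2.2⟩
    exact mem_image.2 ⟨i, mem_univ _, hi⟩
  have hP₂iff : ∀ p, p ∈ P₂ ↔ (p ∈ (fun q => A₂ q + t₂) '' fccStacking 1 (Real.sqrt (2 / 3)) ∧
      h + R₀ ≤ p 2 ∧ p 2 ≤ h + 2 * R₀ ∧ p 0 ^ 2 + p 1 ^ 2 ≤ ρ ^ 2) := by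
    intro p
    rw [hP₂, mem_filter]
    refine ⟨fun hp => hp.2, fun hp => ⟨?_, hp⟩⟩
    obtain ⟨i, hi⟩ := hslab₂ p hp.1 ⟨hp.2.1, hp.2.2.1, hp.2.2.2⟩
    rw [mem_sdiff]
    refine ⟨mem_image.2 ⟨i, mem_univ _, hi⟩, fun hp1 => ?_⟩
    have h1 := ((hP₁iff p).1 hp1).2.2.1
    have h2 := hp.2.1
    linarith
  have hadh' := hadh h hh ρ hρ X P₁ P₂ hXpack hP₁X hP₂X hXcyl hP₁iff hP₂iff
  have hD₁ := hC₁ (-(2 * R₀)) (-R₀) (by ring) ρ hρ P₁ hP₁iff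
  have hD₂ := hC₂ (h + R₀) (h + 2 * R₀) (by ring) ρ hρ P₂ hP₂iff
  have hsplit₁ := contactDeficiency_sdiff_split hP₁X
  have hsplit₂ := contactDeficiency_sdiff_split hP₂X
  have hDX : contactDeficiency X = 6 * (N : ℝ) - (numContacts x : ℝ) :=
    contactDeficiency_image_eq x hxinj
  rw [← hDX]
  have hρ0 : (0 : ℝ) ≤ ρ := by linarith
  have ha : C * (1 + h) * ρ ≤ |C| * (1 + h) * ρ := by
    have h1 : 0 ≤ (|C| - C) * ((1 + h) * ρ) := mul_nonneg (by linarith only [le_abs_self C]) (by positivity)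
    linarith only [h1]
  have hb : C₁ * ρ ≤ |C₁| * (1 + h) * ρ := by
    have h1 : 0 ≤ (|C₁| - C₁) * ρ := mul_nonneg (by linarith only [le_abs_self C₁]) hρ0
    have h2 : 0 ≤ |C₁| * h * ρ := by positivity
    linarith only [h1, h2]
  have hc' : C₂ * ρ ≤ |C₂| * (1 + h) * ρ := by
    have h1 : 0 ≤ (|C₂| - C₂) * ρ := mul_nonneg (by linarith only [le_abs_self C₂]) hρ0
    have h2 : 0 ≤ |C₂| * h * ρ := by positivity
    linarith only [h1, h2]
  linarith only [hadh', hD₁, hD₂, hsplit₁, hsplit₂, ha, hb, hc']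

end Summit.Ventures.Crystal3D.Theorems

end
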